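import Literature.Geometry.Lorentzian.EndNormSqConvex
import Literature.Geometry.Lorentzian.EndCylindricalRadius
import HarnessLib

/-!
# Schoen–Yau 1979, (2.4)–(2.5) and p. 57: confinement of minimal surfaces on an end
# (the global maximum principle from the pointwise ones)

Schoen–Yau, Comm. Math. Phys. 65 (1979), §2, Step 2, pp. 50–51, argue three times in the same
way: a coordinate function `ψ` restricted to a minimal surface has `Δ_S ψ > 0` far out on the end,
hence no interior local maximum there, *"so we may apply the maximum principle to conclude"* a
global bound from the boundary values:

* (2.4), p. 50: *"`|y|²` is a convex function for `|y| ≥ τ₁` … Since `∂S_σ ∩ N_{k'} = ∅`, we may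
  apply the maximum principle to conclude that `S_σ ∩ N_{k'} ⊆ B_{τ₁}(0)`"*;
* (2.5), pp. 50–51: *"Let `h̄ = max {h, σ₀}` be the maximum for `x³` on `S_σ ∩ N_k`, and suppose
  this maximum occurs at the point `x₀ ∈ S_σ`. … contradicting the fact that `x³` attains a
  maximum there. A similar argument gives a lower bound on `x³|S_σ ∩ N_k`. We have thus established
  (2.5)"* (`S_σ ∩ N_k ⊆ E_h = {|x³| ≤ h}` with `h` independent of `σ`);
* p. 57 (second proof of the Claim): *"on `∂F(Θ)` we have `r' = σ`, and inside `F(Θ)` at some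
  points we have `r' > σ`. Thus `r'` takes a maximum at some point of `F(Θ̄)`. We claim that `(r')²`
  is a subharmonic function on `S` for `r'` sufficiently large, which will give a contradiction"*.

The three pointwise statements — no local maximum far out of `⟪u, x⟫|_S` (`M < 0`), of `|x|²|_S` and
of `(r')²|_S = (|x|² − ⟪u, x⟫²)|_S` on a spacelike immersed surface with `H ≡ 0` — are the theorems
`SchoenYau.not_isLocalMax_height` (`SchoenYauHeightBound.lean`), `SchoenYau.not_isLocalMax_normSq`
(`EndNormSqConvex.lean`) and `SchoenYau.not_isLocalMax_cylSq` (`EndCylindricalRadius.lean`). This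
file supplies the passage to the **global** statements, i.e. the elementary maximum principle
"a function without interior local maxima above level `c`, and `≤ c` on the boundary, is `≤ c`",
in a form that does not presuppose a manifold-with-boundary structure:

* `forall_le_of_isCompact_of_not_isLocalMax` — **the topological maximum principle**: `K` a set,
  `V ⊆ K` open, `φ ≤ c` on `K ∖ V`, the superlevel sets `{y ∈ K | t ≤ φ y}` (`t > c`) compact, `φ`
  continuous and without local maxima at the points of `V` where `φ > c`; then `φ ≤ c` on `K`
  (a maximum point of `φ` on a compact superlevel set would be an interior local maximum). The case
  `K = V = univ` is the statement for surfaces "with boundary at infinity"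
  (`forall_le_of_isCompact_superlevel_of_not_isLocalMax`); `forall_ge_…` are the versions for minima.
* `AFEnd.isClosed_setOf_le_norm_coord`, `AFEnd.isClosed_preimage_coord` — the closed far pieces
  `{t ≤ ‖x‖}` (`t > R`) and, more generally, `x⁻¹(T)` for closed `T ⊆ {t ≤ ‖·‖}`, are closed in `X`
  (the end is closed at infinity, `AFEnd.isClosed_far`; needed because the global coordinate
  `AFEnd.coord` is extended by `0` off the end and is discontinuous across its inner boundary).
* `SchoenYau.height_le_of_forall_diff_le` / `SchoenYau.abs_height_le_of_forall_diff_le` —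
  **(2.5), global form**: there is `h₀ > 0` (depending only on the end, `M < 0`) such that for
  every spacelike immersed surface `F : S → X` with smooth unit normal and `H ≡ 0`, every unit `u`,
  every compact `K ⊆ S`, open `V ⊆ K` and level `c ≥ h₀`: if `⟪u, x ∘ F⟫ ≤ c` (resp. `|⟪u, x ∘ F⟫| ≤ c`)
  on `K ∖ V` then the same holds on all of `K`; and the boundaryless form
  `SchoenYau.height_le_of_isCompact_superlevel` (compact superlevel sets above `c` ⇒ `⟪u, x ∘ F⟫ ≤ c`).
* `SchoenYau.norm_coord_le_of_forall_diff_le`, `SchoenYau.norm_coord_le_of_isCompact_superlevel`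
  — **(2.4), global form** (any `M`): with `ρ₁ > 0` depending only on the end, `‖x ∘ F‖ ≤ c` on
  `K ∖ V` and `c ≥ ρ₁` imply `‖x ∘ F‖ ≤ c` on `K`.
* `SchoenYau.cylSq_le_of_forall_diff_le` — **p. 57, global form** (any `M`): with `ρ₂ > 0` depending
  only on the end, `|x ∘ F|² − ⟪u, x ∘ F⟫² ≤ c²` on `K ∖ V` and `c ≥ ρ₂` imply the same on `K`
  ("`r'` cannot take an interior maximum `> σ` on `F(Θ̄)` when `r' = σ` on `∂F(Θ)`").

Everything is proved; no definitions, no named facts, no `sorry`.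

## References

* R. Schoen, S.-T. Yau, *On the proof of the positive mass conjecture in general relativity*,
  Comm. Math. Phys. 65 (1979) 45–76, §2 Step 2, (2.4)–(2.5) (pp. 50–51); second proof of the
  Claim, p. 57. [SchoenYauPMT1979]
-/

noncomputable section

open Bundle Set Function Filter Metric
open scoped Manifold ContDiff Topology RealInnerProductSpace

namespace Literature.Geometry.Lorentzian

/-! ### The topological maximum principle -/

section MaximumPrinciple

variable {S : Type*} [TopologicalSpace S]

/-- **Maximum principle, topological form.** Let `V ⊆ K ⊆ S` with `V` open, `φ : S → ℝ` with
`φ ≤ c` on `K ∖ V` ("on the boundary"), such that for every `t > c` the superlevel set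
`{y ∈ K | t ≤ φ y}` is compact, `φ` is continuous at every point of `V` where `φ > c`, and `φ` has
no local maximum at any point of `V` where `φ > c`. Then `φ ≤ c` on `K`. (If `φ y₁ > c`, a maximum
point `y₀` of `φ` on the compact superlevel set `{φ ≥ φ y₁} ∩ K ⊆ V` is a local maximum of `φ` with
`φ y₀ > c`.) This is the step *"`x³` attains a maximum … contradicting"* of Schoen–Yau 1979,
pp. 50–51 and *"`r'` takes a maximum at some point of `F(Θ̄)` … which will give a contradiction"*,
p. 57. [cite: SchoenYauPMT1979, §2 Step 2, pp. 50–51] -/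
theorem forall_le_of_isCompact_of_not_isLocalMax {φ : S → ℝ} {K V : Set S} {c : ℝ}
    (hVK : V ⊆ K) (hV : IsOpen V) (hbd : ∀ y ∈ K \ V, φ y ≤ c)
    (hKt : ∀ t, c < t → IsCompact {y | y ∈ K ∧ t ≤ φ y})
    (hcont : ∀ y ∈ V, c < φ y → ContinuousAt φ y)
    (hmax : ∀ y ∈ V, c < φ y → ¬ IsLocalMax φ y) : ∀ y ∈ K, φ y ≤ c := by
  by_contra! H
  obtain ⟨y₁, hy₁K, hy₁⟩ := H
  set t := φ y₁ with ht
  have hKc : IsCompact {y | y ∈ K ∧ t ≤ φ y} := hKt t hy₁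
  have hy₁mem : y₁ ∈ {y | y ∈ K ∧ t ≤ φ y} := ⟨hy₁K, le_rfl⟩
  -- the superlevel set lies in `V`
  have hsubV : ∀ y ∈ {y | y ∈ K ∧ t ≤ φ y}, y ∈ V := by
    intro y hy
    by_contra hyV
    have h1 := hbd y ⟨hy.1, hyV⟩
    have h2 : t ≤ φ y := hy.2
    linarith
  have hcontK : ContinuousOn φ {y | y ∈ K ∧ t ≤ φ y} := fun y hy ↦
    (hcont y (hsubV y hy) (lt_of_lt_of_le hy₁ hy.2)).continuousWithinAt
  obtain ⟨y₀, hy₀mem, hy₀max⟩ := hKc.exists_isMaxOn ⟨y₁, hy₁mem⟩ hcontK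
  have hy₀V : y₀ ∈ V := hsubV y₀ hy₀mem
  have ht₀ : t ≤ φ y₀ := hy₀mem.2
  have hloc : IsLocalMax φ y₀ := by
    show ∀ᶠ y in 𝓝 y₀, φ y ≤ φ y₀
    filter_upwards [hV.mem_nhds hy₀V] with y hyV
    by_cases hty : t ≤ φ y
    · exact hy₀max ⟨hVK hyV, hty⟩
    · exact (le_of_lt (not_le.1 hty)).trans ht₀
  exact hmax y₀ hy₀V (lt_of_lt_of_le hy₁ ht₀) hloc

/-- **Maximum principle for a surface "with boundary at infinity"**: if the superlevel sets
`{t ≤ φ}` (`t > c`) are compact, `φ` is continuous where `φ > c` and has no local maximum where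
`φ > c`, then `φ ≤ c` everywhere (the case `K = V = univ` of
`forall_le_of_isCompact_of_not_isLocalMax`). [cite: SchoenYauPMT1979, §2 Step 2, pp. 50–51] -/
theorem forall_le_of_isCompact_superlevel_of_not_isLocalMax {φ : S → ℝ} {c : ℝ}
    (hKt : ∀ t, c < t → IsCompact {y | t ≤ φ y})
    (hcont : ∀ y, c < φ y → ContinuousAt φ y)
    (hmax : ∀ y, c < φ y → ¬ IsLocalMax φ y) : ∀ y, φ y ≤ c := by
  have h := forall_le_of_isCompact_of_not_isLocalMax (φ := φ) (K := univ) (V := univ) (c := c)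
    Subset.rfl isOpen_univ (fun y hy ↦ absurd (mem_univ y) hy.2)
    (fun t ht ↦ by simpa using hKt t ht) (fun y _ hy ↦ hcont y hy) (fun y _ hy ↦ hmax y hy)
  exact fun y ↦ h y (mem_univ y)

/-- **Minimum principle, topological form** (`forall_le_of_isCompact_of_not_isLocalMax` for `−φ`):
`φ ≥ c` on `K ∖ V`, compact sublevel sets `{y ∈ K | φ y ≤ t}` (`t < c`), continuity and no local
minimum at the points of `V` where `φ < c` imply `φ ≥ c` on `K`.
[cite: SchoenYauPMT1979, §2 Step 2, p. 51 ("A similar argument gives a lower bound")] -/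
theorem forall_ge_of_isCompact_of_not_isLocalMin {φ : S → ℝ} {K V : Set S} {c : ℝ}
    (hVK : V ⊆ K) (hV : IsOpen V) (hbd : ∀ y ∈ K \ V, c ≤ φ y)
    (hKt : ∀ t, t < c → IsCompact {y | y ∈ K ∧ φ y ≤ t})
    (hcont : ∀ y ∈ V, φ y < c → ContinuousAt φ y)
    (hmin : ∀ y ∈ V, φ y < c → ¬ IsLocalMin φ y) : ∀ y ∈ K, c ≤ φ y := by
  have h := forall_le_of_isCompact_of_not_isLocalMax (φ := fun y ↦ -φ y) (K := K) (V := V)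
    (c := -c) hVK hV (fun y hy ↦ neg_le_neg (hbd y hy))
    (fun t ht ↦ by
      have heq : {y | y ∈ K ∧ t ≤ -φ y} = {y | y ∈ K ∧ φ y ≤ -t} := by
        ext y; simp only [mem_setOf_eq]
        exact ⟨fun h ↦ ⟨h.1, by linarith [h.2]⟩, fun h ↦ ⟨h.1, by linarith [h.2]⟩⟩
      rw [heq]; exact hKt (-t) (by linarith))
    (fun y hyV hy ↦ (hcont y hyV (by linarith)).neg)
    (fun y hyV hy hmax ↦ hmin y hyV (by linarith) (by simpa using hmax.neg))
  exact fun y hy ↦ by have := h y hy; linarith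

end MaximumPrinciple


/-! ### Closed far pieces of an end -/

namespace AFEnd

variable {X : Type} [TopologicalSpace X] [ChartedSpace E3 X] (e : AFEnd X)

/-- A point with non-zero global coordinate lies in the end (off the end `coord = 0`).
[folklore] -/
theorem mem_U_of_norm_coord_pos {q : X} (hq : 0 < ‖e.coord q‖) : q ∈ e.U := by
  by_contra h
  rw [e.coord_of_not_mem h, norm_zero] at hq
  exact lt_irrefl _ hq

/-- For `t > R` the superlevel set `{t ≤ ‖coord‖}` of the global coordinate is the closed far
piece `Φ({t ≤ ‖x‖})` of the end. [folklore] -/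
theorem setOf_le_norm_coord_eq {t : ℝ} (ht : e.R < t) :
    {q : X | t ≤ ‖e.coord q‖} = ((↑) : e.U → X) '' (e.chart ⁻¹' {x | t ≤ ‖(x : E3)‖}) := by
  ext q
  rw [mem_setOf_eq, e.mem_image_preimage_le_norm_iff]
  exact ⟨fun hq ↦ ⟨e.mem_U_of_norm_coord_pos ((e.R_pos.trans ht).trans_le hq), hq⟩,
    fun ⟨_, hq⟩ ↦ hq⟩

/-- **The closed far pieces are closed**: for `t > R`, `{q | t ≤ ‖coord q‖}` is closed in `X`
(the end is closed at infinity, `AFEnd.isClosed_far`). [folklore] -/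
theorem isClosed_setOf_le_norm_coord {t : ℝ} (ht : e.R < t) :
    IsClosed {q : X | t ≤ ‖e.coord q‖} := by
  rw [e.setOf_le_norm_coord_eq ht]
  exact e.isClosed_far t ht

/-- The global coordinate is continuous at the points of the end. [folklore] -/
theorem continuousAt_coord {q : X} (hq : q ∈ e.U) : ContinuousAt e.coord q :=
  (e.contMDiffAt_coord hq).continuousAt

/-- The global coordinate is continuous on each closed far piece `{t ≤ ‖coord‖}`, `t > R`.
[folklore] -/
theorem continuousOn_coord_setOf_le_norm {t : ℝ} (ht : e.R < t) :
    ContinuousOn e.coord {q : X | t ≤ ‖e.coord q‖} := fun _ hq ↦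
  (e.continuousAt_coord (e.mem_U_of_norm_coord_pos ((e.R_pos.trans ht).trans_le hq))).continuousWithinAt

/-- **Preimages of closed far sets are closed**: if `T ⊆ ℝ³` is closed and contained in
`{t ≤ ‖x‖}` for some `t > R`, then `coord⁻¹(T)` is closed in `X` — although `coord`, extended by `0`
off the end, is not continuous on `X`. [folklore] -/
theorem isClosed_preimage_coord {T : Set E3} (hT : IsClosed T) {t : ℝ} (ht : e.R < t)
    (hTt : T ⊆ {x | t ≤ ‖x‖}) : IsClosed (e.coord ⁻¹' T) := by
  have heq : e.coord ⁻¹' T = {q | t ≤ ‖e.coord q‖} ∩ e.coord ⁻¹' T := by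
    ext q
    exact ⟨fun h ↦ ⟨hTt h, h⟩, fun h ↦ h.2⟩
  rw [heq]
  exact (e.continuousOn_coord_setOf_le_norm ht).preimage_isClosed_of_isClosed
    (e.isClosed_setOf_le_norm_coord ht) hT

end AFEnd

/-! ### Schoen–Yau's confinement statements, global form -/

namespace SchoenYau

variable {X : Type} [TopologicalSpace X] [ChartedSpace E3 X] [IsManifold (𝓡 3) ∞ X]
  (e : AFEnd X) (D : InitialDataSet (𝓡 3) X) [D.metric.HasLeviCivita]

/-- **Schoen–Yau 1979, (2.5), global form (general region).** Let the end `e` of the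
`3`-dimensional data `D` have the expansion (1.1) to second order with `M < 0`. There is `h₀ > 0`
such that: for every surface `S`, every spacelike immersion `F : S → X` with smooth unit normal and
mean curvature `H ≡ 0`, every unit vector `u`, every `V ⊆ K ⊆ S` with `V` open and every level
`c ≥ h₀`, if the height `⟪u, x ∘ F⟫` is `≤ c` on `K ∖ V` and its superlevel sets in `K` above `c` are
compact, then `⟪u, x ∘ F⟫ ≤ c` on `K`. Printed for `u = e₃`, `K = S_σ`, `V` its interior: *"Let `h̄`
be the maximum for `x³` on `S_σ ∩ N_k`, and suppose this maximum occurs at the point `x₀ ∈ S_σ` …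
contradicting the fact that `x³` attains a maximum there"* (the pointwise step is
`not_isLocalMax_height`, the passage to the maximum is `forall_le_of_isCompact_of_not_isLocalMax`).
[cite: SchoenYauPMT1979, §2 Step 2, (2.5), pp. 50–51] -/
theorem height_le_of_forall_diff_le_of_isCompact_superlevel {M : ℝ}
    (hAS : IsAsymptoticallySchwarzschild e D M 2) (hM : M < 0) :
    ∃ h₀ : ℝ, 0 < h₀ ∧ ∀ (S : Type) [TopologicalSpace S]
      [ChartedSpace (EuclideanSpace ℝ (Fin 2)) S] [IsManifold (𝓡 2) ∞ S] (F : S → X)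
      (hpb : PseudoRiemannianMetric.contMDiff_pullbackBilin (𝓡 3) X (𝓡 2) S ∞)
      (hfi : D.metric.IsSpacelikeImmersion (𝓡 2) F) (ν : NormalField (𝓡 3) F),
      ContMDiff (𝓡 2) (𝓡 3).tangent ∞
          (fun y ↦ (TotalSpace.mk' E3 (F y) (ν y) : TangentBundle (𝓡 3) X)) →
      D.metric.IsUnitNormal (𝓡 2) F ν 1 →
      (∀ y, D.metric.meanCurvature F hpb hfi ν y = 0) →
      ∀ u : E3, ‖u‖ = 1 → ∀ (K V : Set S) (c : ℝ), IsOpen V → V ⊆ K → h₀ ≤ c →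
        (∀ t, c < t → IsCompact {y | y ∈ K ∧ t ≤ ⟪u, e.coord (F y)⟫}) →
        (∀ y ∈ K \ V, ⟪u, e.coord (F y)⟫ ≤ c) → ∀ y ∈ K, ⟪u, e.coord (F y)⟫ ≤ c := by
  obtain ⟨h₀, hh₀, H⟩ := not_isLocalMax_height e D hAS hM
  refine ⟨h₀, hh₀, ?_⟩
  intro S _ _ _ F hpb hfi ν hν hun hmin u hu K V c hV hVK hc hKt hbd
  have hFc : Continuous F := hfi.contMDiff_self.continuous
  have hinner : ∀ x : E3, ⟪u, x⟫ ≤ ‖x‖ := fun x ↦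
    (real_inner_le_norm u x).trans (by rw [hu, one_mul])
  refine forall_le_of_isCompact_of_not_isLocalMax hVK hV hbd hKt ?_ ?_
  · intro y _ hy
    have hpos : 0 < ‖e.coord (F y)‖ := by linarith [hinner (e.coord (F y))]
    have hU : F y ∈ e.U := e.mem_U_of_norm_coord_pos hpos
    have hci : Continuous fun x : E3 ↦ ⟪u, x⟫ := continuous_const.inner continuous_id
    exact hci.continuousAt.comp ((e.continuousAt_coord hU).comp hFc.continuousAt)
  · intro y _ hy
    exact H S F hpb hfi ν hν hun hmin u hu y (hc.trans_lt hy)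

/-- **Schoen–Yau 1979, (2.5), global form on a compact region.** With `h₀ > 0` depending only on
the end (`M < 0`): for every spacelike immersed surface `F : S → X` with smooth unit normal and
`H ≡ 0`, every unit `u`, every compact `K ⊆ S`, open `V ⊆ K` and `c ≥ h₀`, if `⟪u, x ∘ F⟫ ≤ c` on
`K ∖ V` then `⟪u, x ∘ F⟫ ≤ c` on `K` — *"we may apply the maximum principle"*; the superlevel sets
`{y ∈ K | t ≤ ⟪u, x(F y)⟫}`, `t > c ≥ h₀ ≥ R`, are compact as `x⁻¹{t ≤ ⟪u, ·⟫}` is closed in `X`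
(`AFEnd.isClosed_preimage_coord`). [cite: SchoenYauPMT1979, §2 Step 2, (2.5), pp. 50–51] -/
theorem height_le_of_forall_diff_le {M : ℝ}
    (hAS : IsAsymptoticallySchwarzschild e D M 2) (hM : M < 0) :
    ∃ h₀ : ℝ, 0 < h₀ ∧ ∀ (S : Type) [TopologicalSpace S]
      [ChartedSpace (EuclideanSpace ℝ (Fin 2)) S] [IsManifold (𝓡 2) ∞ S] (F : S → X)
      (hpb : PseudoRiemannianMetric.contMDiff_pullbackBilin (𝓡 3) X (𝓡 2) S ∞)
      (hfi : D.metric.IsSpacelikeImmersion (𝓡 2) F) (ν : NormalField (𝓡 3) F),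
      ContMDiff (𝓡 2) (𝓡 3).tangent ∞
          (fun y ↦ (TotalSpace.mk' E3 (F y) (ν y) : TangentBundle (𝓡 3) X)) →
      D.metric.IsUnitNormal (𝓡 2) F ν 1 →
      (∀ y, D.metric.meanCurvature F hpb hfi ν y = 0) →
      ∀ u : E3, ‖u‖ = 1 → ∀ (K V : Set S) (c : ℝ), IsCompact K → IsOpen V → V ⊆ K → h₀ ≤ c →
        (∀ y ∈ K \ V, ⟪u, e.coord (F y)⟫ ≤ c) → ∀ y ∈ K, ⟪u, e.coord (F y)⟫ ≤ c := by
  obtain ⟨h₀, hh₀, H⟩ := height_le_of_forall_diff_le_of_isCompact_superlevel e D hAS hM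
  refine ⟨max h₀ e.R, lt_max_of_lt_left hh₀, ?_⟩
  intro S _ _ _ F hpb hfi ν hν hun hmin u hu K V c hK hV hVK hc hbd
  have hFc : Continuous F := hfi.contMDiff_self.continuous
  have hinner : ∀ x : E3, ⟪u, x⟫ ≤ ‖x‖ := fun x ↦
    (real_inner_le_norm u x).trans (by rw [hu, one_mul])
  have hci : Continuous fun x : E3 ↦ ⟪u, x⟫ := continuous_const.inner continuous_id
  refine H S F hpb hfi ν hν hun hmin u hu K V c hV hVK ((le_max_left _ _).trans hc) ?_ hbd
  intro t ht
  have hRt : e.R < t := ((le_max_right _ _).trans hc).trans_lt ht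
  have hclosed : IsClosed (e.coord ⁻¹' {x : E3 | t ≤ ⟪u, x⟫}) :=
    e.isClosed_preimage_coord (isClosed_le continuous_const hci) hRt
      (fun x hx ↦ le_trans hx (hinner x))
  have heq : {y | y ∈ K ∧ t ≤ ⟪u, e.coord (F y)⟫} =
      K ∩ F ⁻¹' (e.coord ⁻¹' {x : E3 | t ≤ ⟪u, x⟫}) := by
    ext y; exact Iff.rfl
  rw [heq]
  exact hK.inter_right (hclosed.preimage hFc)

/-- **Schoen–Yau 1979, (2.5), global form for a surface with boundary at infinity.** With
`h₀ > 0` depending only on the end (`M < 0`): if, on a spacelike immersed surface with smooth unit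
normal and `H ≡ 0`, the superlevel sets `{t ≤ ⟪u, x ∘ F⟫}` above the level `c ≥ h₀` are compact
(the height "does not exceed `c` at the boundary or at infinity of `S`"), then `⟪u, x ∘ F⟫ ≤ c` on
all of `S`. [cite: SchoenYauPMT1979, §2 Step 2, (2.5), pp. 50–51] -/
theorem height_le_of_isCompact_superlevel {M : ℝ}
    (hAS : IsAsymptoticallySchwarzschild e D M 2) (hM : M < 0) :
    ∃ h₀ : ℝ, 0 < h₀ ∧ ∀ (S : Type) [TopologicalSpace S]
      [ChartedSpace (EuclideanSpace ℝ (Fin 2)) S] [IsManifold (𝓡 2) ∞ S] (F : S → X)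
      (hpb : PseudoRiemannianMetric.contMDiff_pullbackBilin (𝓡 3) X (𝓡 2) S ∞)
      (hfi : D.metric.IsSpacelikeImmersion (𝓡 2) F) (ν : NormalField (𝓡 3) F),
      ContMDiff (𝓡 2) (𝓡 3).tangent ∞
          (fun y ↦ (TotalSpace.mk' E3 (F y) (ν y) : TangentBundle (𝓡 3) X)) →
      D.metric.IsUnitNormal (𝓡 2) F ν 1 →
      (∀ y, D.metric.meanCurvature F hpb hfi ν y = 0) →
      ∀ u : E3, ‖u‖ = 1 → ∀ c : ℝ, h₀ ≤ c →
        (∀ t, c < t → IsCompact {y | t ≤ ⟪u, e.coord (F y)⟫}) → ∀ y, ⟪u, e.coord (F y)⟫ ≤ c := by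
  obtain ⟨h₀, hh₀, H⟩ := height_le_of_forall_diff_le_of_isCompact_superlevel e D hAS hM
  refine ⟨h₀, hh₀, ?_⟩
  intro S _ _ _ F hpb hfi ν hν hun hmin u hu c hc hKt y
  refine H S F hpb hfi ν hν hun hmin u hu univ univ c isOpen_univ Subset.rfl hc
    (fun t ht ↦ by simpa using hKt t ht) (fun y hy ↦ absurd (mem_univ y) hy.2) y (mem_univ y)

/-- **Schoen–Yau 1979, (2.5), both halves: `S_σ ∩ N_k ⊆ E_h`.** With `h₀ > 0` depending only on
the end (`M < 0`): for every spacelike immersed surface with smooth unit normal and `H ≡ 0`, every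
unit `u`, compact `K`, open `V ⊆ K` and `c ≥ h₀`, if `|⟪u, x ∘ F⟫| ≤ c` on `K ∖ V` then
`|⟪u, x ∘ F⟫| ≤ c` on `K` (*"A similar argument gives a lower bound on `x³|S_σ ∩ N_k`. We have thus
established (2.5)"*; the lower bound is the upper bound for `−u`).
[cite: SchoenYauPMT1979, §2 Step 2, (2.5), p. 51] -/
theorem abs_height_le_of_forall_diff_le {M : ℝ}
    (hAS : IsAsymptoticallySchwarzschild e D M 2) (hM : M < 0) :
    ∃ h₀ : ℝ, 0 < h₀ ∧ ∀ (S : Type) [TopologicalSpace S]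
      [ChartedSpace (EuclideanSpace ℝ (Fin 2)) S] [IsManifold (𝓡 2) ∞ S] (F : S → X)
      (hpb : PseudoRiemannianMetric.contMDiff_pullbackBilin (𝓡 3) X (𝓡 2) S ∞)
      (hfi : D.metric.IsSpacelikeImmersion (𝓡 2) F) (ν : NormalField (𝓡 3) F),
      ContMDiff (𝓡 2) (𝓡 3).tangent ∞
          (fun y ↦ (TotalSpace.mk' E3 (F y) (ν y) : TangentBundle (𝓡 3) X)) →
      D.metric.IsUnitNormal (𝓡 2) F ν 1 →
      (∀ y, D.metric.meanCurvature F hpb hfi ν y = 0) →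
      ∀ u : E3, ‖u‖ = 1 → ∀ (K V : Set S) (c : ℝ), IsCompact K → IsOpen V → V ⊆ K → h₀ ≤ c →
        (∀ y ∈ K \ V, |⟪u, e.coord (F y)⟫| ≤ c) → ∀ y ∈ K, |⟪u, e.coord (F y)⟫| ≤ c := by
  obtain ⟨h₀, hh₀, H⟩ := height_le_of_forall_diff_le e D hAS hM
  refine ⟨h₀, hh₀, ?_⟩
  intro S _ _ _ F hpb hfi ν hν hun hmin u hu K V c hK hV hVK hc hbd y hy
  have hu' : ‖-u‖ = 1 := by rw [norm_neg, hu]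
  have hup := H S F hpb hfi ν hν hun hmin u hu K V c hK hV hVK hc
    (fun y hy ↦ (le_abs_self _).trans (hbd y hy)) y hy
  have hlow := H S F hpb hfi ν hν hun hmin (-u) hu' K V c hK hV hVK hc
    (fun y hy ↦ by rw [inner_neg_left]; exact (neg_le_abs _).trans (hbd y hy)) y hy
  rw [inner_neg_left] at hlow
  exact abs_le.2 ⟨by linarith, hup⟩

/-- **Schoen–Yau 1979, (2.4), global form on a compact region.** Let the end `e` have the
expansion (1.1) to second order (any `M`). There is `ρ₁ > 0` such that: for every spacelike immersed
surface `F : S → X` with smooth unit normal and `H ≡ 0`, every compact `K ⊆ S`, open `V ⊆ K` and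
`c ≥ ρ₁`, if `‖x ∘ F‖ ≤ c` on `K ∖ V` then `‖x ∘ F‖ ≤ c` on `K`. Printed: *"`|y|²` is a convex
function for `|y| ≥ τ₁` … Since `∂S_σ ∩ N_{k'} = ∅`, we may apply the maximum principle to conclude
that `S_σ ∩ N_{k'} ⊆ B_{τ₁}(0)`"* (pointwise step `not_isLocalMax_normSq`; also the "convex hull
property" invoked on p. 56). [cite: SchoenYauPMT1979, §2 Step 2, (2.4), p. 50] -/
theorem norm_coord_le_of_forall_diff_le {M : ℝ} (hAS : IsAsymptoticallySchwarzschild e D M 2) :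
    ∃ ρ₁ : ℝ, 0 < ρ₁ ∧ ∀ (S : Type) [TopologicalSpace S]
      [ChartedSpace (EuclideanSpace ℝ (Fin 2)) S] [IsManifold (𝓡 2) ∞ S] (F : S → X)
      (hpb : PseudoRiemannianMetric.contMDiff_pullbackBilin (𝓡 3) X (𝓡 2) S ∞)
      (hfi : D.metric.IsSpacelikeImmersion (𝓡 2) F) (ν : NormalField (𝓡 3) F),
      ContMDiff (𝓡 2) (𝓡 3).tangent ∞
          (fun y ↦ (TotalSpace.mk' E3 (F y) (ν y) : TangentBundle (𝓡 3) X)) →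
      D.metric.IsUnitNormal (𝓡 2) F ν 1 →
      (∀ y, D.metric.meanCurvature F hpb hfi ν y = 0) →
      ∀ (K V : Set S) (c : ℝ), IsCompact K → IsOpen V → V ⊆ K → ρ₁ ≤ c →
        (∀ y ∈ K \ V, ‖e.coord (F y)‖ ≤ c) → ∀ y ∈ K, ‖e.coord (F y)‖ ≤ c := by
  obtain ⟨ρ₀, hρ₀, H⟩ := not_isLocalMax_normSq e D hAS
  refine ⟨max ρ₀ e.R, lt_max_of_lt_left hρ₀, ?_⟩
  intro S _ _ _ F hpb hfi ν hν hun hmin K V c hK hV hVK hc hbd y hy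
  have hFc : Continuous F := hfi.contMDiff_self.continuous
  have hρc : ρ₀ ≤ c := (le_max_left _ _).trans hc
  have hRc : e.R ≤ c := (le_max_right _ _).trans hc
  have hc0 : 0 ≤ c := hρ₀.le.trans hρc
  -- maximum principle for `φ = ‖x ∘ F‖²` at the level `c²`
  have key : ∀ y ∈ K, ‖e.coord (F y)‖ ^ 2 ≤ c ^ 2 := by
    refine forall_le_of_isCompact_of_not_isLocalMax hVK hV
      (fun y hy ↦ pow_le_pow_left₀ (norm_nonneg _) (hbd y hy) 2) ?_ ?_ ?_
    · intro t ht
      have ht0 : 0 < t := (sq_nonneg c).trans_lt ht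
      have hRt : e.R < Real.sqrt t := by
        rw [show e.R = Real.sqrt (e.R ^ 2) by rw [Real.sqrt_sq e.R_pos.le]]
        exact Real.sqrt_lt_sqrt (sq_nonneg _) ((pow_le_pow_left₀ e.R_pos.le hRc 2).trans_lt ht)
      have hclosed : IsClosed (e.coord ⁻¹' {x : E3 | t ≤ ‖x‖ ^ 2}) :=
        e.isClosed_preimage_coord (isClosed_le continuous_const (continuous_norm.pow 2)) hRt
          (fun x hx ↦ by
            have hx' : t ≤ ‖x‖ ^ 2 := hx
            calc Real.sqrt t ≤ Real.sqrt (‖x‖ ^ 2) := Real.sqrt_le_sqrt hx'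
              _ = ‖x‖ := Real.sqrt_sq (norm_nonneg _))
      have heq : {y | y ∈ K ∧ t ≤ ‖e.coord (F y)‖ ^ 2} =
          K ∩ F ⁻¹' (e.coord ⁻¹' {x : E3 | t ≤ ‖x‖ ^ 2}) := by
        ext y; exact Iff.rfl
      rw [heq]
      exact hK.inter_right (hclosed.preimage hFc)
    · intro y _ hy
      have hpos : 0 < ‖e.coord (F y)‖ := by
        have : c ^ 2 < ‖e.coord (F y)‖ ^ 2 := hy
        nlinarith [norm_nonneg (e.coord (F y))]
      have hU : F y ∈ e.U := e.mem_U_of_norm_coord_pos hpos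
      exact (continuous_norm.pow 2).continuousAt.comp
        ((e.continuousAt_coord hU).comp hFc.continuousAt)
    · intro y _ hy
      refine H S F hpb hfi ν hν hun hmin y ?_
      have : c ^ 2 < ‖e.coord (F y)‖ ^ 2 := hy
      have hlt : c < ‖e.coord (F y)‖ := by nlinarith [norm_nonneg (e.coord (F y))]
      exact hρc.trans_lt hlt
  have h2 := key y hy
  nlinarith [norm_nonneg (e.coord (F y))]

/-- **Schoen–Yau 1979, (2.4), global form for a surface with boundary at infinity**: with
`ρ₁ > 0` depending only on the end, if on a spacelike immersed surface with smooth unit normal and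
`H ≡ 0` the superlevel sets `{t ≤ ‖x ∘ F‖}` above the level `c ≥ ρ₁` are compact, then
`‖x ∘ F‖ ≤ c` on all of `S`. [cite: SchoenYauPMT1979, §2 Step 2, (2.4), p. 50] -/
theorem norm_coord_le_of_isCompact_superlevel {M : ℝ}
    (hAS : IsAsymptoticallySchwarzschild e D M 2) :
    ∃ ρ₁ : ℝ, 0 < ρ₁ ∧ ∀ (S : Type) [TopologicalSpace S]
      [ChartedSpace (EuclideanSpace ℝ (Fin 2)) S] [IsManifold (𝓡 2) ∞ S] (F : S → X)
      (hpb : PseudoRiemannianMetric.contMDiff_pullbackBilin (𝓡 3) X (𝓡 2) S ∞)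
      (hfi : D.metric.IsSpacelikeImmersion (𝓡 2) F) (ν : NormalField (𝓡 3) F),
      ContMDiff (𝓡 2) (𝓡 3).tangent ∞
          (fun y ↦ (TotalSpace.mk' E3 (F y) (ν y) : TangentBundle (𝓡 3) X)) →
      D.metric.IsUnitNormal (𝓡 2) F ν 1 →
      (∀ y, D.metric.meanCurvature F hpb hfi ν y = 0) →
      ∀ c : ℝ, ρ₁ ≤ c → (∀ t, c < t → IsCompact {y | t ≤ ‖e.coord (F y)‖}) →
        ∀ y, ‖e.coord (F y)‖ ≤ c := by
  obtain ⟨ρ₀, hρ₀, H⟩ := not_isLocalMax_normSq e D hAS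
  refine ⟨ρ₀, hρ₀, ?_⟩
  intro S _ _ _ F hpb hfi ν hν hun hmin c hc hKt y
  have hFc : Continuous F := hfi.contMDiff_self.continuous
  have hc0 : 0 ≤ c := hρ₀.le.trans hc
  have key : ∀ y, ‖e.coord (F y)‖ ^ 2 ≤ c ^ 2 := by
    refine forall_le_of_isCompact_superlevel_of_not_isLocalMax ?_ ?_ ?_
    · intro t ht
      have ht0 : 0 ≤ t := (sq_nonneg c).trans ht.le
      have hct : c < Real.sqrt t := by
        rw [show c = Real.sqrt (c ^ 2) by rw [Real.sqrt_sq hc0]]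
        exact Real.sqrt_lt_sqrt (sq_nonneg _) ht
      have heq : {y | t ≤ ‖e.coord (F y)‖ ^ 2} = {y | Real.sqrt t ≤ ‖e.coord (F y)‖} := by
        ext y
        simp only [mem_setOf_eq]
        constructor
        · intro h
          calc Real.sqrt t ≤ Real.sqrt (‖e.coord (F y)‖ ^ 2) := Real.sqrt_le_sqrt h
            _ = ‖e.coord (F y)‖ := Real.sqrt_sq (norm_nonneg _)
        · intro h
          calc t = Real.sqrt t ^ 2 := (Real.sq_sqrt ht0).symm
            _ ≤ ‖e.coord (F y)‖ ^ 2 := pow_le_pow_left₀ (Real.sqrt_nonneg _) h 2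
      rw [heq]
      exact hKt _ hct
    · intro y hy
      have hpos : 0 < ‖e.coord (F y)‖ := by
        have : c ^ 2 < ‖e.coord (F y)‖ ^ 2 := hy
        nlinarith [norm_nonneg (e.coord (F y))]
      have hU : F y ∈ e.U := e.mem_U_of_norm_coord_pos hpos
      exact (continuous_norm.pow 2).continuousAt.comp
        ((e.continuousAt_coord hU).comp hFc.continuousAt)
    · intro y hy
      refine H S F hpb hfi ν hν hun hmin y ?_
      have : c ^ 2 < ‖e.coord (F y)‖ ^ 2 := hy
      have hlt : c < ‖e.coord (F y)‖ := by nlinarith [norm_nonneg (e.coord (F y))]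
      exact hc.trans_lt hlt
  have h2 := key y
  nlinarith [norm_nonneg (e.coord (F y))]

/-- **Schoen–Yau 1979, p. 57: `r'` takes no interior maximum `> σ` on `F(Θ̄)`, global form.** Let
the end `e` have the expansion (1.1) to second order (any `M`). There is `ρ₂ > 0` such that: for
every spacelike immersed surface `F : S → X` with smooth unit normal and `H ≡ 0`, every unit `u`
(printed `u = e₃`, `(r')² = |x|² − ⟪u, x⟫²`), every compact `K ⊆ S`, open `V ⊆ K` and `c ≥ ρ₂`, if
`|x ∘ F|² − ⟪u, x ∘ F⟫² ≤ c²` on `K ∖ V` then the same holds on `K`. Printed with `K = F(Θ̄)`,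
`V = F(Θ)`, `c = σ`: *"on `∂F(Θ)` we have `r' = σ`, and inside `F(Θ)` at some points we have
`r' > σ`. Thus `r'` takes a maximum at some point of `F(Θ̄)` … `(r')²` is a subharmonic function on
`S` for `r'` sufficiently large, which will give a contradiction"* (pointwise step
`not_isLocalMax_cylSq`). [cite: SchoenYauPMT1979, §2, second proof of the Claim, p. 57] -/
theorem cylSq_le_of_forall_diff_le {M : ℝ} (hAS : IsAsymptoticallySchwarzschild e D M 2) :
    ∃ ρ₂ : ℝ, 0 < ρ₂ ∧ ∀ (S : Type) [TopologicalSpace S]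
      [ChartedSpace (EuclideanSpace ℝ (Fin 2)) S] [IsManifold (𝓡 2) ∞ S] (F : S → X)
      (hpb : PseudoRiemannianMetric.contMDiff_pullbackBilin (𝓡 3) X (𝓡 2) S ∞)
      (hfi : D.metric.IsSpacelikeImmersion (𝓡 2) F) (ν : NormalField (𝓡 3) F),
      ContMDiff (𝓡 2) (𝓡 3).tangent ∞
          (fun y ↦ (TotalSpace.mk' E3 (F y) (ν y) : TangentBundle (𝓡 3) X)) →
      D.metric.IsUnitNormal (𝓡 2) F ν 1 →
      (∀ y, D.metric.meanCurvature F hpb hfi ν y = 0) →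
      ∀ u : E3, ‖u‖ = 1 → ∀ (K V : Set S) (c : ℝ), IsCompact K → IsOpen V → V ⊆ K → ρ₂ ≤ c →
        (∀ y ∈ K \ V, ‖e.coord (F y)‖ ^ 2 - ⟪u, e.coord (F y)⟫ ^ 2 ≤ c ^ 2) →
        ∀ y ∈ K, ‖e.coord (F y)‖ ^ 2 - ⟪u, e.coord (F y)⟫ ^ 2 ≤ c ^ 2 := by
  obtain ⟨ρ₀, hρ₀, H⟩ := not_isLocalMax_cylSq e D hAS
  refine ⟨max ρ₀ e.R, lt_max_of_lt_left hρ₀, ?_⟩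
  intro S _ _ _ F hpb hfi ν hν hun hmin u hu K V c hK hV hVK hc hbd
  have hFc : Continuous F := hfi.contMDiff_self.continuous
  have hρc : ρ₀ ≤ c := (le_max_left _ _).trans hc
  have hRc : e.R ≤ c := (le_max_right _ _).trans hc
  have hc0 : 0 ≤ c := hρ₀.le.trans hρc
  have hci : Continuous fun x : E3 ↦ ‖x‖ ^ 2 - ⟪u, x⟫ ^ 2 :=
    (continuous_norm.pow 2).sub ((continuous_const.inner continuous_id).pow 2)
  -- `c² < |x|² − ⟪u,x⟫² ≤ |x|²` forces `‖x‖ > c`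
  have hnorm_gt : ∀ x : E3, c ^ 2 < ‖x‖ ^ 2 - ⟪u, x⟫ ^ 2 → c < ‖x‖ := fun x hx ↦ by
    nlinarith [norm_nonneg x, sq_nonneg ⟪u, x⟫]
  refine forall_le_of_isCompact_of_not_isLocalMax hVK hV hbd ?_ ?_ ?_
  · intro t ht
    have ht0 : 0 < t := (sq_nonneg c).trans_lt ht
    have hRt : e.R < Real.sqrt t := by
      rw [show e.R = Real.sqrt (e.R ^ 2) by rw [Real.sqrt_sq e.R_pos.le]]
      exact Real.sqrt_lt_sqrt (sq_nonneg _) ((pow_le_pow_left₀ e.R_pos.le hRc 2).trans_lt ht)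
    have hclosed : IsClosed (e.coord ⁻¹' {x : E3 | t ≤ ‖x‖ ^ 2 - ⟪u, x⟫ ^ 2}) :=
      e.isClosed_preimage_coord (isClosed_le continuous_const hci) hRt
        (fun x hx ↦ by
          have hx' : t ≤ ‖x‖ ^ 2 - ⟪u, x⟫ ^ 2 := hx
          have hx2 : t ≤ ‖x‖ ^ 2 := by nlinarith [sq_nonneg ⟪u, x⟫]
          calc Real.sqrt t ≤ Real.sqrt (‖x‖ ^ 2) := Real.sqrt_le_sqrt hx2
            _ = ‖x‖ := Real.sqrt_sq (norm_nonneg _))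
    have heq : {y | y ∈ K ∧ t ≤ ‖e.coord (F y)‖ ^ 2 - ⟪u, e.coord (F y)⟫ ^ 2} =
        K ∩ F ⁻¹' (e.coord ⁻¹' {x : E3 | t ≤ ‖x‖ ^ 2 - ⟪u, x⟫ ^ 2}) := by
      ext y; exact Iff.rfl
    rw [heq]
    exact hK.inter_right (hclosed.preimage hFc)
  · intro y _ hy
    have hpos : 0 < ‖e.coord (F y)‖ := hc0.trans_lt (hnorm_gt _ hy)
    have hU : F y ∈ e.U := e.mem_U_of_norm_coord_pos hpos
    exact hci.continuousAt.comp ((e.continuousAt_coord hU).comp hFc.continuousAt)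
  · intro y _ hy
    exact H S F hpb hfi ν hν hun hmin u hu y (hρc.trans_lt (hnorm_gt _ hy))

end SchoenYau

end Literature.Geometry.Lorentzian
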